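/-
Copyright: cell pub-balaban-gaps, seat ne8 (estimate NE7c), gen 16. Project licence.
-/
import Summits.Ventures.LatticeQCDFlow.Scaling.SpecialUnitarySmallBall
import Summits.QuantumFields.BalabanUV.T4Continuum.Spine.NE7b.CompactFibreWindowSUNRate
import Summits.QuantumFields.BalabanUV.T4Continuum.Spine.NE7c.LiveFactorWindowTight

/-!
# The live factor's window-volume price is EXACT on `SU(N)` for EVERY `N`: `Haar(SB μη) ∕ Haar(SB η) → μ^{N²−1}` (Hilbert–Schmidt ball) and
# `Haar(W_{νt}) ∕ Haar(W_t) → (√ν)^{N²−1}` (trace window) as the window shrinks — road (δ)'s loss `½·d(𝔤)·log ν⁻¹` per plaquette variable,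
# `d(𝔤) = dim SU(N) = N² − 1`, is ATTAINED and file 30's constant is `D = 1 + o(1)` uniformly on the grid (row NE7c; the ALL-`N` form of junction J-16♯ =
# file 31 `LiveFactorWindowTight`; MODEL, [folklore]) — BY NAME from the tree's exact small-ball asymptotic of `SU(N)`

Cell `pub-balaban-gaps` (G2), seat ne8, estimate **NE7c** (`T4IndicatorShell.ShellWeightBound`; two-run artefact, NOT PRINTED in [Bałaban 1983–89], NOT PROVED).
Proof-only file under `Spine/NE7c/`: imports the tree's `Summits/Ventures/LatticeQCDFlow/Scaling/SpecialUnitarySmallBall` (cell pub-lqcd: **`SUN.exists_tendsto_haar_closedBall_div_pow`**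
— `Haar_{SU(N)}(B̄_HS(1, t)) ∕ t^{N²−1} → C₀ ∈ (0, ∞)` as `t → 0⁺`, `N ≥ 1`, from von Neumann's exponential chart of the closed linear group `SU(N)`, strict differentiability
of `exp` at `0` and `dim 𝔰𝔲(N) = N² − 1`; no Weyl formula, `C₀` not valued), seat ne6's V29 `Spine/NE7b/CompactFibreWindowSUNRate` (trace dictionary `traceWindow_eq_sball`:
`{Re tr(1 − V) ≤ t} = SB √(2t)`; `exists_haarReal_sball_two_sided` for positivity; V20's `pi_sball_toReal_eq`) and this seat's file 31 `LiveFactorWindowTight`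
(`tendsto_window_div_sqrt_cube`: `Haar_{SU(2)}(W_t) ∕ (√t)³ → 2∕(3π)`, V40a's cap law).  Mathlib real analysis otherwise.  Nothing of Bałaban's is named; no `def`; 0 `sorry`.

THE QUESTION (census `HOME/ne/NE7c.md` §21 row 48 (iii), §22 row 49; open point (vi) of HANDOFF § GEN 15).  File 30 (`LiveFactorWindowDoubling`) reads the lineage's doubling
at a live window for every `N`: `μ^{N²−1}·Haar(SB η) ≤ D·Haar(SB μη)` (`exists_live_sball_ge`), `(√ν)^{N²−1}·Haar(W_t) ≤ D·Haar(W_{νt})` (`exists_live_traceWindow_ge`), ONE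
soft constant `D ≥ 1` (V38), `D = 1` for `N = 2` (V40c); file 31 showed for `N = 2` that the loss `ν^{3∕2}` is attained as `t → 0⁺`.  For `N ≥ 3` the census had V29's
two-sided law `C⁻¹η^{N²−1} ≤ Haar(SB η) ≤ Cη^{N²−1}` (rate pinned, ratio not).  Is the live loss `μ^{N²−1}` really there for every `N`, and is `D` an artefact?

ANSWER ([folklore]; the tree's exact asymptotic read in the lineage's vocabulary):
* §1 real analysis on `m` with `m(s)∕s^d → C₀ > 0` at `0⁺`: RATIO `m(μs)∕m(s) → μ^d` (`tendsto_ratio_of_tendsto_div_pow`); the ε-band (`band_of_tendsto_div_pow`); TWO-SIDED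
  small-window control `μ^d·m(η) ≤ (1 + ε)·m(μη)` and `m(μη) ≤ (1 + ε)·μ^d·m(η)` for ALL `0 < η < η₀(ε)` and ALL `μ ∈ (0, 1]` at once (`two_sided_of_tendsto_div_pow`;
  uniform because `μη < η₀` whenever `η < η₀`); LOG form `|−log m(μη) − (−log m(η)) − d·log μ⁻¹| ≤ ε` (`log_form_of_tendsto_div_pow`).
* §2 `SU(N)`, `SB η = {‖V − 1‖_HS ≤ η}`, EVERY `N` (`N = 0` trivially): **`exists_tendsto_haar_sball_div_pow`** (`Haar(SB η)∕η^{N²−1} → C₀ > 0`), **`tendsto_live_sball_ratio`**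
  (`Haar(SB μη)∕Haar(SB η) → μ^{N²−1}`, every `μ > 0`), **`live_sball_two_sided`** (∀ ε ∃ η₀ ∀ 0 < η < η₀ ∀ μ ∈ (0,1]: `μ^{N²−1}Haar(SB η) ≤ (1 + ε)Haar(SB μη)` — file 30's
  `exists_live_sball_ge` with `D = 1 + ε`, every `N` — AND `Haar(SB μη) ≤ (1 + ε)μ^{N²−1}Haar(SB η)` — the loss is attained), **`live_sball_log_form`** (the unlowered letter
  VERBATIM plus `(N² − 1)·log μ⁻¹` up to `ε`, both directions), and the region form on `bonds → SU(N)` (`tendsto_live_pi_sball_ratio`: `→ μ^{#B·(N²−1)}`).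
* §3 TRACE window `W_t = {Re tr(1 − V) ≤ t} = SB √(2t)` (files 30∕31's currency): `tendsto_haar_traceWindow_div_sqrt_pow` (`Haar(W_t)∕(√(2t))^{N²−1} → C₀`, the same `C₀`),
  **`tendsto_live_traceWindow_ratio`** (`→ (√ν)^{N²−1}`, every `ν > 0`, every `N`), **`live_traceWindow_two_sided`** (file 30's `exists_live_traceWindow_ge` with
  `D = 1 + ε` below `t₀(ε)`, plus the ceiling), **`exists_live_traceWindow_ratio_lt`** (the all-`N` form of file 31's `exists_live_ratio_lt`).
* §4 CROSS-CHECK at `N = 2` of two independent kernel derivations (exponential chart vs V40a's cap law): **`tendsto_haar_sball_div_cube_SU2`** (`Haar_{SU(2)}(SB δ)∕δ³ →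
  1∕(3√2·π)`, file 31 read at `t = δ²∕2`) and **`asymptotic_const_SU2_eq`**: the tree's `C₀` at `N = 2` IS `1∕(3√2·π) ≈ 0.0750 = vol B³ ∕ vol_HS SU(2) = (4π∕3)∕(2π²·2√2)`.

CENSUS (row 50, NEW; `ne/NE7c.md` §23): road (δ)'s price in the window-VOLUME currency — `½·d(𝔤)·log ν⁻¹` per plaquette variable RELATIVE to the unlowered letter,
`d(𝔤) = N² − 1` — is EXACT for EVERY `N` in the small-window regime: attained (no finer reading makes the volume letter FREE for any `N`) and with multiplicative
constant `1 + o(1)` uniformly over the grid `ν ∈ (0, 1]` (file 30's soft `D` matters only for large windows); rows 44 ∕ 47 (i) ∕ 48 (i),(iii) ∕ 49 (i) hold for `SU(N)`,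
every `N`, with the loss term sharp.  BY-NAME EFFECT ON THE WALL: none (junction ∕ census file).
NOT HERE (honest): the VALUE of `C₀` for `N ≥ 3` (Weyl's integration formula ∕ `vol_HS SU(N)`; road (δ) reads RATIOS only, so `C₀` cancels — print's own `log σ₀`
stays FREE, file 30); which `t(g_k)` ∕ `η(g_k)` Bałaban's step carries ((A3) ∕ (A1c); NC-NE7b-α UNRULED); node O; NE7c.  VERDICT WORD UNCHANGED: WORK-bound behind
node O; INSTANCE 0∕1.  NE7c ∕ NE7b NOT PRINTED ∕ NOT PROVED; spine 0∕9; one finite T⁴ — NOT ℝ⁴, NOT infinite volume, NOT the mass gap, NOT Clay.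
HONEST DEPENDENCY (cell): continuum YM on T⁴ ⇐ BetaPertH ∧ nine spine estimates (0∕9 proved); BetaPertH ⇐ (D1) ∧ (D4) ∧ CAP+tail.
-/

set_option autoImplicit false

noncomputable section

open MeasureTheory Real Filter Set Topology Metric
open scoped Matrix.Norms.Frobenius
open Literature.MathematicalPhysics.QuantumFieldTheory (haarProbability)
open Summit.Ventures.LatticeQCDFlow.Theory2.Lattice.SUN (exists_tendsto_haar_closedBall_div_pow)
open Summit.QuantumFields.BalabanUV.T4Continuum.NE7b.CompactFibreWindowSUN (pi_sball_toReal_eq)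
open Summit.QuantumFields.BalabanUV.T4Continuum.NE7b.CompactFibreWindowSUNRate (traceWindow_eq_sball exists_haarReal_sball_two_sided)
open Summit.QuantumFields.BalabanUV.T4Continuum.Spine.NE7c.LiveFactorWindowTight (tendsto_window_div_sqrt_cube)

namespace Summit.QuantumFields.BalabanUV.T4Continuum.Spine.NE7c.LiveFactorWindowTightSUN

/-! ## §1 Real analysis: what a power asymptotic `m(s)∕s^d → C₀ > 0` at `0⁺` gives for ratios -/

section Abstract

variable {m : ℝ → ℝ} {d : ℕ} {C₀ : ℝ}

/-- `δ ↦ μδ` maps `0⁺` to `0⁺` for `μ > 0`. [folklore] -/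
theorem tendsto_const_mul_nhdsGT {μ : ℝ} (hμ : 0 < μ) : Tendsto (fun δ : ℝ => μ * δ) (𝓝[>] 0) (𝓝[>] 0) := by
  refine tendsto_nhdsWithin_iff.2 ⟨?_, ?_⟩
  · have h : Tendsto (fun δ : ℝ => μ * δ) (𝓝 0) (𝓝 (μ * 0)) := tendsto_const_nhds.mul tendsto_id
    rw [mul_zero] at h
    exact h.mono_left nhdsWithin_le_nhds
  · filter_upwards [self_mem_nhdsWithin] with δ hδ
    exact mul_pos hμ (Set.mem_Ioi.1 hδ)

/-- **RATIO LIMIT FROM A POWER ASYMPTOTIC**: if `m(s)∕s^d → C₀ ≠ 0` as `s → 0⁺`, then `m(μs)∕m(s) → μ^d` as `s → 0⁺` for every `μ > 0`. [folklore] -/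
theorem tendsto_ratio_of_tendsto_div_pow (h : Tendsto (fun s : ℝ => m s / s ^ d) (𝓝[>] 0) (𝓝 C₀)) (hC₀ : C₀ ≠ 0)
    {μ : ℝ} (hμ : 0 < μ) : Tendsto (fun s : ℝ => m (μ * s) / m s) (𝓝[>] 0) (𝓝 (μ ^ d)) := by
  have h1 : Tendsto (fun s : ℝ => m (μ * s) / (μ * s) ^ d) (𝓝[>] 0) (𝓝 C₀) := h.comp (tendsto_const_mul_nhdsGT hμ)
  have h2 : Tendsto (fun s : ℝ => m (μ * s) / (μ * s) ^ d * μ ^ d / (m s / s ^ d)) (𝓝[>] 0) (𝓝 (C₀ * μ ^ d / C₀)) :=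
    (h1.mul_const _).div h hC₀
  rw [mul_div_cancel_left₀ _ hC₀] at h2
  refine h2.congr' ?_
  filter_upwards [self_mem_nhdsWithin] with s hs
  have hs' : s ^ d ≠ 0 := pow_ne_zero _ (ne_of_gt (Set.mem_Ioi.1 hs))
  have hμ' : μ ^ d ≠ 0 := pow_ne_zero _ hμ.ne'
  rw [mul_pow, mul_comm (μ ^ d) (s ^ d), ← div_div, div_mul_cancel₀ _ hμ', div_div_div_cancel_right₀ hs']

/-- The ε-band of a power asymptotic: `m(s)∕s^d → C₀` as `s → 0⁺` gives, for every `e > 0`, a radius `η₀ > 0` with `(C₀ − e)·s^d < m(s) < (C₀ + e)·s^d`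
for all `0 < s < η₀`. [folklore] -/
theorem band_of_tendsto_div_pow (h : Tendsto (fun s : ℝ => m s / s ^ d) (𝓝[>] 0) (𝓝 C₀)) {e : ℝ} (he : 0 < e) :
    ∃ η₀ : ℝ, 0 < η₀ ∧ ∀ s : ℝ, 0 < s → s < η₀ → (C₀ - e) * s ^ d < m s ∧ m s < (C₀ + e) * s ^ d := by
  obtain ⟨η₀, hη₀, hb⟩ := Metric.tendsto_nhdsWithin_nhds.1 h e he
  refine ⟨η₀, hη₀, fun s hs hsη₀ => ?_⟩
  have hsd : 0 < s ^ d := pow_pos hs d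
  have hb' := hb (Set.mem_Ioi.2 hs) (by rwa [dist_zero_right, Real.norm_eq_abs, abs_of_pos hs])
  rw [Real.dist_eq, abs_lt] at hb'
  exact ⟨(lt_div_iff₀ hsd).1 (by linarith [hb'.1]), (div_lt_iff₀ hsd).1 (by linarith [hb'.2])⟩

/-- **TWO-SIDED SMALL-WINDOW CONTROL, UNIFORM ON THE GRID**: if `m(s)∕s^d → C₀ > 0` as `s → 0⁺`, then for every `ε > 0` there is `η₀ > 0` with
`μ^d·m(η) ≤ (1 + ε)·m(μη)` and `m(μη) ≤ (1 + ε)·μ^d·m(η)` for ALL `0 < η < η₀` and ALL `0 < μ ≤ 1` (uniformly: `μη < η₀` as soon as `η < η₀`). [folklore] -/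
theorem two_sided_of_tendsto_div_pow (h : Tendsto (fun s : ℝ => m s / s ^ d) (𝓝[>] 0) (𝓝 C₀)) (hC₀ : 0 < C₀) {ε : ℝ} (hε : 0 < ε) :
    ∃ η₀ : ℝ, 0 < η₀ ∧ ∀ η : ℝ, 0 < η → η < η₀ → ∀ μ : ℝ, 0 < μ → μ ≤ 1 →
      μ ^ d * m η ≤ (1 + ε) * m (μ * η) ∧ m (μ * η) ≤ (1 + ε) * μ ^ d * m η := by
  set ε₁ := min ε 1 with hε₁
  have hε₁0 : 0 < ε₁ := lt_min hε one_pos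
  have hε₁1 : ε₁ ≤ 1 := min_le_right _ _
  have hε₁ε : ε₁ ≤ ε := min_le_left _ _
  have hεC : 0 < ε₁ * C₀ := mul_pos hε₁0 hC₀
  obtain ⟨η₀, hη₀, band⟩ := band_of_tendsto_div_pow h (by positivity : 0 < ε₁ * C₀ / 3)
  refine ⟨η₀, hη₀, fun η hη hηη₀ μ hμ hμ1 => ?_⟩
  have hμη : 0 < μ * η := mul_pos hμ hη
  obtain ⟨hlo1, hup1⟩ := band (μ * η) hμη (lt_of_le_of_lt (mul_le_of_le_one_left hη.le hμ1) hηη₀)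
  obtain ⟨hlo2, hup2⟩ := band η hη hηη₀
  have hμd : 0 ≤ μ ^ d := pow_nonneg hμ.le d
  have hηd : 0 < η ^ d := pow_pos hη d
  have ha : 0 < C₀ - ε₁ * C₀ / 3 := by nlinarith
  have key : C₀ + ε₁ * C₀ / 3 ≤ (1 + ε₁) * (C₀ - ε₁ * C₀ / 3) := by nlinarith
  have hm1 : 0 ≤ m (μ * η) := le_trans (mul_nonneg ha.le (pow_nonneg hμη.le d)) hlo1.le
  have hm2 : 0 ≤ m η := le_trans (mul_nonneg ha.le hηd.le) hlo2.le
  rw [mul_pow] at hlo1 hup1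
  constructor
  · calc μ ^ d * m η ≤ μ ^ d * ((C₀ + ε₁ * C₀ / 3) * η ^ d) := mul_le_mul_of_nonneg_left hup2.le hμd
      _ ≤ μ ^ d * ((1 + ε₁) * (C₀ - ε₁ * C₀ / 3) * η ^ d) := mul_le_mul_of_nonneg_left (mul_le_mul_of_nonneg_right key hηd.le) hμd
      _ = (1 + ε₁) * ((C₀ - ε₁ * C₀ / 3) * (μ ^ d * η ^ d)) := by ring
      _ ≤ (1 + ε₁) * m (μ * η) := mul_le_mul_of_nonneg_left hlo1.le (by linarith)
      _ ≤ (1 + ε) * m (μ * η) := mul_le_mul_of_nonneg_right (by linarith) hm1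
  · calc m (μ * η) ≤ (C₀ + ε₁ * C₀ / 3) * (μ ^ d * η ^ d) := hup1.le
      _ ≤ (1 + ε₁) * (C₀ - ε₁ * C₀ / 3) * (μ ^ d * η ^ d) := mul_le_mul_of_nonneg_right key (mul_nonneg hμd hηd.le)
      _ = (1 + ε₁) * μ ^ d * ((C₀ - ε₁ * C₀ / 3) * η ^ d) := by ring
      _ ≤ (1 + ε₁) * μ ^ d * m η := mul_le_mul_of_nonneg_left hlo2.le (mul_nonneg (by linarith) hμd)
      _ ≤ (1 + ε) * μ ^ d * m η := mul_le_mul_of_nonneg_right (mul_le_mul_of_nonneg_right (by linarith) hμd) hm2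

/-- **THE LOG FORM**: if `m(s)∕s^d → C₀ > 0` as `s → 0⁺`, then for every `ε > 0` there is `η₀ > 0` such that for ALL `0 < η < η₀` and ALL `0 < μ ≤ 1` both
`m(η)` and `m(μη)` are positive and `|−log m(μη) − (−log m(η)) − d·log μ⁻¹| ≤ ε` — the letter at the lowered radius IS the unlowered letter plus
`d·log μ⁻¹`, up to `ε`. [folklore] -/
theorem log_form_of_tendsto_div_pow (h : Tendsto (fun s : ℝ => m s / s ^ d) (𝓝[>] 0) (𝓝 C₀)) (hC₀ : 0 < C₀) {ε : ℝ} (hε : 0 < ε) :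
    ∃ η₀ : ℝ, 0 < η₀ ∧ ∀ η : ℝ, 0 < η → η < η₀ → ∀ μ : ℝ, 0 < μ → μ ≤ 1 →
      0 < m η ∧ 0 < m (μ * η) ∧ |-Real.log (m (μ * η)) - (-Real.log (m η)) - (d : ℝ) * Real.log μ⁻¹| ≤ ε := by
  have hlog : Tendsto (fun s : ℝ => Real.log (m s / s ^ d)) (𝓝[>] 0) (𝓝 (Real.log C₀)) :=
    ((Real.continuousAt_log hC₀.ne').tendsto).comp h
  obtain ⟨η₁, hη₁, hb₁⟩ := band_of_tendsto_div_pow h (half_pos hC₀)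
  obtain ⟨η₂, hη₂, hb₂⟩ := Metric.tendsto_nhdsWithin_nhds.1 hlog (ε / 2) (by positivity)
  refine ⟨min η₁ η₂, lt_min hη₁ hη₂, fun η hη hηη₀ μ hμ hμ1 => ?_⟩
  have pos : ∀ s : ℝ, 0 < s → s < min η₁ η₂ → 0 < m s := fun s hs hs' =>
    lt_trans (mul_pos (by linarith) (pow_pos hs d)) (hb₁ s hs (lt_of_lt_of_le hs' (min_le_left _ _))).1
  have band : ∀ s : ℝ, 0 < s → s < min η₁ η₂ → |Real.log (m s / s ^ d) - Real.log C₀| < ε / 2 := by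
    intro s hs hs'
    have hb := hb₂ (Set.mem_Ioi.2 hs)
      (by rw [dist_zero_right, Real.norm_eq_abs, abs_of_pos hs]; exact lt_of_lt_of_le hs' (min_le_right _ _))
    rwa [Real.dist_eq] at hb
  have hμη : 0 < μ * η := mul_pos hμ hη
  have hμη' : μ * η < min η₁ η₂ := lt_of_le_of_lt (mul_le_of_le_one_left hη.le hμ1) hηη₀
  have hmη := pos η hη hηη₀
  have hmμη := pos (μ * η) hμη hμη'
  refine ⟨hmη, hmμη, ?_⟩
  have e1 : Real.log (m (μ * η) / (μ * η) ^ d) = Real.log (m (μ * η)) - d * (Real.log μ + Real.log η) := by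
    rw [Real.log_div hmμη.ne' (pow_ne_zero _ hμη.ne'), Real.log_pow, Real.log_mul hμ.ne' hη.ne']
  have e2 : Real.log (m η / η ^ d) = Real.log (m η) - d * Real.log η := by
    rw [Real.log_div hmη.ne' (pow_ne_zero _ hη.ne'), Real.log_pow]
  have e3 : -Real.log (m (μ * η)) - (-Real.log (m η)) - (d : ℝ) * Real.log μ⁻¹ =
      -(Real.log (m (μ * η) / (μ * η) ^ d) - Real.log C₀) + (Real.log (m η / η ^ d) - Real.log C₀) := by
    rw [e1, e2, Real.log_inv]; ring
  rw [e3]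
  have h1 := band (μ * η) hμη hμη'
  have h2 := band η hη hηη₀
  calc |-(Real.log (m (μ * η) / (μ * η) ^ d) - Real.log C₀) + (Real.log (m η / η ^ d) - Real.log C₀)|
      ≤ |-(Real.log (m (μ * η) / (μ * η) ^ d) - Real.log C₀)| + |Real.log (m η / η ^ d) - Real.log C₀| := abs_add_le _ _
    _ ≤ ε := by rw [abs_neg]; linarith [h1, h2]

end Abstract

/-! ## §2 `SU(N)`, the Hilbert–Schmidt ball `SB η = {‖V − 1‖_HS ≤ η}`, every `N` -/

section SUN

variable {N : ℕ}

/-- The Hilbert–Schmidt closed ball of `SU(N)` about `1` IS the lineage's window `SB δ = {‖V − 1‖_HS ≤ δ}`. [folklore] -/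
theorem closedBall_one_eq_sball (δ : ℝ) :
    closedBall (1 : Matrix.specialUnitaryGroup (Fin N) ℂ) δ = {V : Matrix.specialUnitaryGroup (Fin N) ℂ | ‖(V : Matrix (Fin N) (Fin N) ℂ) - 1‖ ≤ δ} := by
  ext V; rw [mem_closedBall, Subtype.dist_eq, dist_eq_norm]; rfl

/-- **THE EXACT SMALL-BALL ASYMPTOTIC OF `SU(N)` IN THE LINEAGE's VOCABULARY, EVERY `N`**: there is `C₀ > 0` with
`Haar_{SU(N)}{‖V − 1‖_HS ≤ η} ∕ η^{N²−1} → C₀` as `η → 0⁺` (`N ≥ 1`: the tree's `SUN.exists_tendsto_haar_closedBall_div_pow`; `N = 0`: `C₀ = 1`). [folklore] -/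
theorem exists_tendsto_haar_sball_div_pow :
    ∃ C₀ : ℝ, 0 < C₀ ∧ Tendsto (fun η : ℝ => (haarProbability (Matrix.specialUnitaryGroup (Fin N) ℂ)).real
      {V : Matrix.specialUnitaryGroup (Fin N) ℂ | ‖(V : Matrix (Fin N) (Fin N) ℂ) - 1‖ ≤ η} / η ^ (N ^ 2 - 1)) (𝓝[>] 0) (𝓝 C₀) := by
  rcases Nat.eq_zero_or_pos N with hN | hN
  · subst hN
    refine ⟨1, one_pos, tendsto_const_nhds.congr' ?_⟩
    filter_upwards [self_mem_nhdsWithin] with η hη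
    have huniv : {V : Matrix.specialUnitaryGroup (Fin 0) ℂ | ‖(V : Matrix (Fin 0) (Fin 0) ℂ) - 1‖ ≤ η} = Set.univ :=
      Set.eq_univ_of_forall fun V => by
        rw [Set.mem_setOf_eq, Subsingleton.elim ((V : Matrix (Fin 0) (Fin 0) ℂ) - 1) 0, norm_zero]; exact le_of_lt (Set.mem_Ioi.1 hη)
    rw [huniv, probReal_univ]; norm_num
  · haveI : NeZero N := ⟨hN.ne'⟩
    obtain ⟨C₀, hC₀, h⟩ := exists_tendsto_haar_closedBall_div_pow (N := N)
    rw [show N * N - 1 = N ^ 2 - 1 by rw [sq]] at h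
    exact ⟨C₀, hC₀, h.congr' (Eventually.of_forall fun η => by simp only [closedBall_one_eq_sball, measureReal_def])⟩

/-- **THE LIVE HILBERT–SCHMIDT BALL HOLDS EXACTLY `μ^{N²−1}` OF THE UNLOWERED ONE IN THE LIMIT, EVERY `N`**: for every radius factor `μ > 0`,
`Haar_{SU(N)}(SB μη) ∕ Haar_{SU(N)}(SB η) → μ^{N²−1}` as `η → 0⁺`. [folklore] -/
theorem tendsto_live_sball_ratio {μ : ℝ} (hμ : 0 < μ) :
    Tendsto (fun η : ℝ => (haarProbability (Matrix.specialUnitaryGroup (Fin N) ℂ)).real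
        {V : Matrix.specialUnitaryGroup (Fin N) ℂ | ‖(V : Matrix (Fin N) (Fin N) ℂ) - 1‖ ≤ μ * η} /
      (haarProbability (Matrix.specialUnitaryGroup (Fin N) ℂ)).real {V : Matrix.specialUnitaryGroup (Fin N) ℂ | ‖(V : Matrix (Fin N) (Fin N) ℂ) - 1‖ ≤ η})
      (𝓝[>] 0) (𝓝 (μ ^ (N ^ 2 - 1))) := by
  obtain ⟨C₀, hC₀, h⟩ := exists_tendsto_haar_sball_div_pow (N := N)
  exact tendsto_ratio_of_tendsto_div_pow h hC₀.ne' hμ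

/-- **FILE 30's CONSTANT IS `1 + o(1)` AND THE LOSS IS ATTAINED, EVERY `N`, UNIFORMLY ON THE GRID**: for every `ε > 0` there is `η₀ > 0` such that for ALL radii
`0 < η < η₀` and ALL factors `0 < μ ≤ 1`: `μ^{N²−1}·Haar(SB η) ≤ (1 + ε)·Haar(SB μη)` (file 30's `exists_live_sball_ge`, `D = 1 + ε`) and `Haar(SB μη) ≤
(1 + ε)·μ^{N²−1}·Haar(SB η)` (the ceiling: the loss `μ^{N²−1}` is there). [folklore] -/
theorem live_sball_two_sided {ε : ℝ} (hε : 0 < ε) :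
    ∃ η₀ : ℝ, 0 < η₀ ∧ ∀ η : ℝ, 0 < η → η < η₀ → ∀ μ : ℝ, 0 < μ → μ ≤ 1 →
      μ ^ (N ^ 2 - 1) * (haarProbability (Matrix.specialUnitaryGroup (Fin N) ℂ)).real {V : Matrix.specialUnitaryGroup (Fin N) ℂ | ‖(V : Matrix (Fin N) (Fin N) ℂ) - 1‖ ≤ η}
        ≤ (1 + ε) * (haarProbability (Matrix.specialUnitaryGroup (Fin N) ℂ)).real {V : Matrix.specialUnitaryGroup (Fin N) ℂ | ‖(V : Matrix (Fin N) (Fin N) ℂ) - 1‖ ≤ μ * η} ∧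
      (haarProbability (Matrix.specialUnitaryGroup (Fin N) ℂ)).real {V : Matrix.specialUnitaryGroup (Fin N) ℂ | ‖(V : Matrix (Fin N) (Fin N) ℂ) - 1‖ ≤ μ * η}
        ≤ (1 + ε) * μ ^ (N ^ 2 - 1) *
          (haarProbability (Matrix.specialUnitaryGroup (Fin N) ℂ)).real {V : Matrix.specialUnitaryGroup (Fin N) ℂ | ‖(V : Matrix (Fin N) (Fin N) ℂ) - 1‖ ≤ η} := by
  obtain ⟨C₀, hC₀, h⟩ := exists_tendsto_haar_sball_div_pow (N := N)
  exact two_sided_of_tendsto_div_pow h hC₀ hε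

/-- **THE LOG FORM, EVERY `N`**: ∀ `ε > 0` ∃ `η₀ > 0` such that for ALL `0 < η < η₀`, ALL `0 < μ ≤ 1` both windows have positive volume and `|−log Haar(SB μη) −
(−log Haar(SB η)) − (N² − 1)·log μ⁻¹| ≤ ε`: the live volume letter IS the unlowered one plus `(N² − 1)·log μ⁻¹ = ½·d(𝔤)·log(μ²)⁻¹`, both directions. [folklore] -/
theorem live_sball_log_form {ε : ℝ} (hε : 0 < ε) :
    ∃ η₀ : ℝ, 0 < η₀ ∧ ∀ η : ℝ, 0 < η → η < η₀ → ∀ μ : ℝ, 0 < μ → μ ≤ 1 →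
      0 < (haarProbability (Matrix.specialUnitaryGroup (Fin N) ℂ)).real {V : Matrix.specialUnitaryGroup (Fin N) ℂ | ‖(V : Matrix (Fin N) (Fin N) ℂ) - 1‖ ≤ η} ∧
      0 < (haarProbability (Matrix.specialUnitaryGroup (Fin N) ℂ)).real {V : Matrix.specialUnitaryGroup (Fin N) ℂ | ‖(V : Matrix (Fin N) (Fin N) ℂ) - 1‖ ≤ μ * η} ∧
      |-Real.log ((haarProbability (Matrix.specialUnitaryGroup (Fin N) ℂ)).real
            {V : Matrix.specialUnitaryGroup (Fin N) ℂ | ‖(V : Matrix (Fin N) (Fin N) ℂ) - 1‖ ≤ μ * η}) -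
          (-Real.log ((haarProbability (Matrix.specialUnitaryGroup (Fin N) ℂ)).real
            {V : Matrix.specialUnitaryGroup (Fin N) ℂ | ‖(V : Matrix (Fin N) (Fin N) ℂ) - 1‖ ≤ η})) - ((N ^ 2 - 1 : ℕ) : ℝ) * Real.log μ⁻¹| ≤ ε := by
  obtain ⟨C₀, hC₀, h⟩ := exists_tendsto_haar_sball_div_pow (N := N)
  exact log_form_of_tendsto_div_pow h hC₀ hε

variable {B : Type*} [Fintype B]

/-- **REGION FORM** (product Haar on `bonds → SU(N)`; V20's `pi_sball_toReal_eq`): `κ(Π_b SB μη) ∕ κ(Π_b SB η) → μ^{#bonds·(N²−1)}` as `η → 0⁺`. [folklore] -/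
theorem tendsto_live_pi_sball_ratio {μ : ℝ} (hμ : 0 < μ) :
    Tendsto (fun η : ℝ =>
      ((Measure.pi fun _ : B => haarProbability (Matrix.specialUnitaryGroup (Fin N) ℂ))
          (Set.univ.pi fun _ : B => {V : Matrix.specialUnitaryGroup (Fin N) ℂ | ‖(V : Matrix (Fin N) (Fin N) ℂ) - 1‖ ≤ μ * η})).toReal /
        ((Measure.pi fun _ : B => haarProbability (Matrix.specialUnitaryGroup (Fin N) ℂ))
          (Set.univ.pi fun _ : B => {V : Matrix.specialUnitaryGroup (Fin N) ℂ | ‖(V : Matrix (Fin N) (Fin N) ℂ) - 1‖ ≤ η})).toReal)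
      (𝓝[>] 0) (𝓝 (μ ^ (Fintype.card B * (N ^ 2 - 1)))) := by
  have h := (tendsto_live_sball_ratio (N := N) hμ).pow (Fintype.card B)
  rw [← pow_mul, mul_comm] at h
  refine h.congr' (Eventually.of_forall fun η => ?_)
  simp only [pi_sball_toReal_eq, measureReal_def]
  rw [div_pow]

end SUN

/-! ## §3 The trace window `W_t = {Re tr(1 − V) ≤ t} = SB √(2t)`, every `N` -/

section Trace

variable {N : ℕ}

/-- `t ↦ √(2t)` maps `0⁺` to `0⁺`. [folklore] -/
theorem tendsto_sqrt_two_mul_nhdsGT : Tendsto (fun t : ℝ => Real.sqrt (2 * t)) (𝓝[>] 0) (𝓝[>] 0) := by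
  refine tendsto_nhdsWithin_iff.2 ⟨?_, ?_⟩
  · have hc : Continuous (fun t : ℝ => Real.sqrt (2 * t)) := Real.continuous_sqrt.comp (continuous_const.mul continuous_id)
    have h0 : Tendsto (fun t : ℝ => Real.sqrt (2 * t)) (𝓝 0) (𝓝 (Real.sqrt (2 * 0))) := hc.tendsto 0
    rw [mul_zero, Real.sqrt_zero] at h0
    exact h0.mono_left nhdsWithin_le_nhds
  · filter_upwards [self_mem_nhdsWithin] with t ht
    exact Real.sqrt_pos.2 (mul_pos two_pos (Set.mem_Ioi.1 ht))

/-- The live trace window is the Hilbert–Schmidt ball of radius `√ν·√(2t)` (`ν, t ≥ 0`; V29's `traceWindow_eq_sball`). [folklore] -/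
theorem live_traceWindow_eq_sball {ν t : ℝ} (hν : 0 ≤ ν) (ht : 0 ≤ t) :
    {V : Matrix.specialUnitaryGroup (Fin N) ℂ | (Matrix.trace (1 - (V : Matrix (Fin N) (Fin N) ℂ))).re ≤ ν * t} =
      {V : Matrix.specialUnitaryGroup (Fin N) ℂ | ‖(V : Matrix (Fin N) (Fin N) ℂ) - 1‖ ≤ Real.sqrt ν * Real.sqrt (2 * t)} := by
  rw [traceWindow_eq_sball (mul_nonneg hν ht), show 2 * (ν * t) = ν * (2 * t) by ring, Real.sqrt_mul hν]

/-- Every trace window of positive level has positive Haar volume in `SU(N)`, every `N` (V29's two-sided law at radius `√(2t)`; V33's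
`haar_sball_real_pos` is the ball form for `N ≥ 1`). [folklore] -/
theorem haarReal_traceWindow_pos {t : ℝ} (ht : 0 < t) :
    0 < (haarProbability (Matrix.specialUnitaryGroup (Fin N) ℂ)).real
      {V : Matrix.specialUnitaryGroup (Fin N) ℂ | (Matrix.trace (1 - (V : Matrix (Fin N) (Fin N) ℂ))).re ≤ t} := by
  have hη : 0 < Real.sqrt (2 * t) := Real.sqrt_pos.2 (by positivity)
  obtain ⟨C, hC, h⟩ := exists_haarReal_sball_two_sided (N := N) hη
  rw [traceWindow_eq_sball ht.le]
  exact lt_of_lt_of_le (mul_pos (inv_pos.2 (lt_of_lt_of_le one_pos hC)) (pow_pos hη _)) (h _ hη le_rfl).1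

/-- **THE TRACE-WINDOW ASYMPTOTIC, EVERY `N`**: a constant `C₀` of §2 (`Haar(SB η)∕η^{N²−1} → C₀`) is also the trace-window constant:
`Haar_{SU(N)}{Re tr(1 − V) ≤ t} ∕ (√(2t))^{N²−1} → C₀` as `t → 0⁺` — the (n)-carrier's window-volume function is `~ C₀·(2t)^{(N²−1)∕2}` (file 31: `N = 2`,
`(2∕(3π))·t^{3∕2}`). [folklore] -/
theorem tendsto_haar_traceWindow_div_sqrt_pow {C₀ : ℝ} (h : Tendsto (fun η : ℝ => (haarProbability (Matrix.specialUnitaryGroup (Fin N) ℂ)).real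
      {V : Matrix.specialUnitaryGroup (Fin N) ℂ | ‖(V : Matrix (Fin N) (Fin N) ℂ) - 1‖ ≤ η} / η ^ (N ^ 2 - 1)) (𝓝[>] 0) (𝓝 C₀)) :
    Tendsto (fun t : ℝ => (haarProbability (Matrix.specialUnitaryGroup (Fin N) ℂ)).real
      {V : Matrix.specialUnitaryGroup (Fin N) ℂ | (Matrix.trace (1 - (V : Matrix (Fin N) (Fin N) ℂ))).re ≤ t} / Real.sqrt (2 * t) ^ (N ^ 2 - 1)) (𝓝[>] 0) (𝓝 C₀) := by
  refine (h.comp tendsto_sqrt_two_mul_nhdsGT).congr' ?_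
  filter_upwards [self_mem_nhdsWithin] with t ht
  rw [Function.comp_apply, traceWindow_eq_sball (le_of_lt (Set.mem_Ioi.1 ht))]

/-- **THE LIVE TRACE WINDOW HOLDS EXACTLY `(√ν)^{N²−1}` OF THE UNLOWERED ONE IN THE LIMIT, EVERY `N`**: for every live factor `ν > 0`,
`Haar_{SU(N)}{Re tr(1 − V) ≤ νt} ∕ Haar_{SU(N)}{Re tr(1 − V) ≤ t} → (√ν)^{N²−1}` as `t → 0⁺` (file 31's `tendsto_live_ratio` is `N = 2`). [folklore] -/
theorem tendsto_live_traceWindow_ratio {ν : ℝ} (hν : 0 < ν) :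
    Tendsto (fun t : ℝ => (haarProbability (Matrix.specialUnitaryGroup (Fin N) ℂ)).real
        {V : Matrix.specialUnitaryGroup (Fin N) ℂ | (Matrix.trace (1 - (V : Matrix (Fin N) (Fin N) ℂ))).re ≤ ν * t} /
      (haarProbability (Matrix.specialUnitaryGroup (Fin N) ℂ)).real
        {V : Matrix.specialUnitaryGroup (Fin N) ℂ | (Matrix.trace (1 - (V : Matrix (Fin N) (Fin N) ℂ))).re ≤ t}) (𝓝[>] 0) (𝓝 (Real.sqrt ν ^ (N ^ 2 - 1))) := by
  refine ((tendsto_live_sball_ratio (N := N) (Real.sqrt_pos.2 hν)).comp tendsto_sqrt_two_mul_nhdsGT).congr' ?_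
  filter_upwards [self_mem_nhdsWithin] with t ht
  have ht0 : 0 ≤ t := le_of_lt (Set.mem_Ioi.1 ht)
  rw [Function.comp_apply, live_traceWindow_eq_sball hν.le ht0, traceWindow_eq_sball ht0]

/-- **TWO-SIDED, UNIFORM ON THE GRID, TRACE CURRENCY, EVERY `N`**: ∀ `ε > 0` ∃ `t₀ > 0` such that for ALL levels `0 < t < t₀` and ALL live factors `0 < ν ≤ 1`:
`(√ν)^{N²−1}·Haar(W_t) ≤ (1 + ε)·Haar(W_{νt})` (file 30's `exists_live_traceWindow_ge` with `D = 1 + ε`) and `Haar(W_{νt}) ≤ (1 + ε)·(√ν)^{N²−1}·Haar(W_t)`. [folklore] -/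
theorem live_traceWindow_two_sided {ε : ℝ} (hε : 0 < ε) :
    ∃ t₀ : ℝ, 0 < t₀ ∧ ∀ t : ℝ, 0 < t → t < t₀ → ∀ ν : ℝ, 0 < ν → ν ≤ 1 →
      Real.sqrt ν ^ (N ^ 2 - 1) * (haarProbability (Matrix.specialUnitaryGroup (Fin N) ℂ)).real
          {V : Matrix.specialUnitaryGroup (Fin N) ℂ | (Matrix.trace (1 - (V : Matrix (Fin N) (Fin N) ℂ))).re ≤ t}
        ≤ (1 + ε) * (haarProbability (Matrix.specialUnitaryGroup (Fin N) ℂ)).real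
          {V : Matrix.specialUnitaryGroup (Fin N) ℂ | (Matrix.trace (1 - (V : Matrix (Fin N) (Fin N) ℂ))).re ≤ ν * t} ∧
      (haarProbability (Matrix.specialUnitaryGroup (Fin N) ℂ)).real
          {V : Matrix.specialUnitaryGroup (Fin N) ℂ | (Matrix.trace (1 - (V : Matrix (Fin N) (Fin N) ℂ))).re ≤ ν * t}
        ≤ (1 + ε) * Real.sqrt ν ^ (N ^ 2 - 1) * (haarProbability (Matrix.specialUnitaryGroup (Fin N) ℂ)).real
          {V : Matrix.specialUnitaryGroup (Fin N) ℂ | (Matrix.trace (1 - (V : Matrix (Fin N) (Fin N) ℂ))).re ≤ t} := by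
  obtain ⟨η₀, hη₀, h⟩ := live_sball_two_sided (N := N) hε
  refine ⟨η₀ ^ 2 / 2, by positivity, fun t ht htt₀ ν hν hν1 => ?_⟩
  have hδ : 0 < Real.sqrt (2 * t) := Real.sqrt_pos.2 (by positivity)
  have hδ' : Real.sqrt (2 * t) < η₀ := by rw [Real.sqrt_lt' hη₀]; nlinarith
  obtain ⟨hlo, hup⟩ := h (Real.sqrt (2 * t)) hδ hδ' (Real.sqrt ν) (Real.sqrt_pos.2 hν) (Real.sqrt_le_one.mpr hν1)
  rw [live_traceWindow_eq_sball hν.le ht.le, traceWindow_eq_sball ht.le]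
  exact ⟨hlo, hup⟩

/-- **THE LOSS `(√ν)^{N²−1}` IS ATTAINED IN THE TRACE CURRENCY, EVERY `N`** (the all-`N` form of file 31's `exists_live_ratio_lt`): for every `ν > 0` and
`ε > 0` there is a level `t > 0` with `Haar(W_t) > 0` and `Haar(W_{νt}) < ((√ν)^{N²−1} + ε)·Haar(W_t)`. [folklore] -/
theorem exists_live_traceWindow_ratio_lt {ν ε : ℝ} (hν : 0 < ν) (hε : 0 < ε) :
    ∃ t : ℝ, 0 < t ∧
      0 < (haarProbability (Matrix.specialUnitaryGroup (Fin N) ℂ)).real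
          {V : Matrix.specialUnitaryGroup (Fin N) ℂ | (Matrix.trace (1 - (V : Matrix (Fin N) (Fin N) ℂ))).re ≤ t} ∧
      (haarProbability (Matrix.specialUnitaryGroup (Fin N) ℂ)).real
          {V : Matrix.specialUnitaryGroup (Fin N) ℂ | (Matrix.trace (1 - (V : Matrix (Fin N) (Fin N) ℂ))).re ≤ ν * t}
        < (Real.sqrt ν ^ (N ^ 2 - 1) + ε) * (haarProbability (Matrix.specialUnitaryGroup (Fin N) ℂ)).real
          {V : Matrix.specialUnitaryGroup (Fin N) ℂ | (Matrix.trace (1 - (V : Matrix (Fin N) (Fin N) ℂ))).re ≤ t} := by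
  have hev := (tendsto_live_traceWindow_ratio (N := N) hν).eventually
    (Iio_mem_nhds (lt_add_of_pos_right (Real.sqrt ν ^ (N ^ 2 - 1)) hε))
  obtain ⟨t, ht, htpos⟩ := (hev.and self_mem_nhdsWithin).exists
  have ht0 : 0 < t := Set.mem_Ioi.1 htpos
  have hpos := haarReal_traceWindow_pos (N := N) ht0
  exact ⟨t, ht0, hpos, (div_lt_iff₀ hpos).1 (Set.mem_Iio.1 ht)⟩

end Trace

/-! ## §4 Cross-check at `N = 2`: the exponential-chart constant against V40a's cap law — `C₀(SU(2)) = 1∕(3√2·π)` -/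

section SU2

/-- `δ ↦ δ²∕2` maps `0⁺` to `0⁺`. [folklore] -/
theorem tendsto_sq_div_two_nhdsGT : Tendsto (fun δ : ℝ => δ ^ 2 / 2) (𝓝[>] 0) (𝓝[>] 0) := by
  refine tendsto_nhdsWithin_iff.2 ⟨?_, ?_⟩
  · have hc : Continuous (fun δ : ℝ => δ ^ 2 / 2) := (continuous_pow 2).div_const 2
    have h0 : Tendsto (fun δ : ℝ => δ ^ 2 / 2) (𝓝 0) (𝓝 ((0 : ℝ) ^ 2 / 2)) := hc.tendsto 0
    rw [zero_pow two_ne_zero, zero_div] at h0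
    exact h0.mono_left nhdsWithin_le_nhds
  · filter_upwards [self_mem_nhdsWithin] with δ hδ
    exact Set.mem_Ioi.2 (by have := Set.mem_Ioi.1 hδ; positivity)

/-- **THE `SU(2)` SMALL-BALL CONSTANT BY VALUE**: `Haar_{SU(2)}{‖V − 1‖_HS ≤ δ} ∕ δ³ → 1∕(3√2·π)` as `δ → 0⁺` — file 31's `Haar(W_t)∕(√t)³ → 2∕(3π)` (V40a's cap
law) read at `t = δ²∕2`; `1∕(3√2·π) = vol B³ ∕ vol_HS SU(2) = (4π∕3) ∕ (2π²·(√2)³)`. [folklore] -/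
theorem tendsto_haar_sball_div_cube_SU2 :
    Tendsto (fun δ : ℝ => (haarProbability (Matrix.specialUnitaryGroup (Fin 2) ℂ)).real
      {V : Matrix.specialUnitaryGroup (Fin 2) ℂ | ‖(V : Matrix (Fin 2) (Fin 2) ℂ) - 1‖ ≤ δ} / δ ^ 3) (𝓝[>] 0) (𝓝 (1 / (3 * Real.sqrt 2 * Real.pi))) := by
  have h1 := (tendsto_window_div_sqrt_cube.comp tendsto_sq_div_two_nhdsGT).div_const (2 * Real.sqrt 2)
  have hs2 : 0 < Real.sqrt 2 := Real.sqrt_pos.2 two_pos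
  rw [show 2 / (3 * Real.pi) / (2 * Real.sqrt 2) = 1 / (3 * Real.sqrt 2 * Real.pi) by field_simp] at h1
  refine h1.congr' ?_
  filter_upwards [self_mem_nhdsWithin] with δ hδ
  have hδ0 : 0 < δ := Set.mem_Ioi.1 hδ
  have e1 : Real.sqrt (2 * (δ ^ 2 / 2)) = δ := by rw [show 2 * (δ ^ 2 / 2) = δ ^ 2 by ring, Real.sqrt_sq hδ0.le]
  have e3 : Real.sqrt 2 ^ 3 = 2 * Real.sqrt 2 := by rw [pow_succ, Real.sq_sqrt (by norm_num : (0 : ℝ) ≤ 2)]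
  have e2 : Real.sqrt (δ ^ 2 / 2) ^ 3 = δ ^ 3 / (2 * Real.sqrt 2) := by
    rw [Real.sqrt_div (sq_nonneg δ), Real.sqrt_sq hδ0.le, div_pow, e3]
  rw [Function.comp_apply, traceWindow_eq_sball (by positivity : (0 : ℝ) ≤ δ ^ 2 / 2), e1, e2]
  field_simp

/-- **THE TREE's CONSTANT AT `N = 2` IS `1∕(3√2·π)`**: any `C₀` with `Haar_{SU(2)}(SB δ)∕δ^{2²−1} → C₀` as `δ → 0⁺` (§2's `exists_tendsto_haar_sball_div_pow` at `N = 2`, i.e.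
the tree's `SUN.exists_tendsto_haar_closedBall_div_pow`, exponential chart) equals the cap-law value `1∕(3√2·π)` — two independent kernel derivations agree. [folklore] -/
theorem asymptotic_const_SU2_eq {C₀ : ℝ} (h : Tendsto (fun δ : ℝ => (haarProbability (Matrix.specialUnitaryGroup (Fin 2) ℂ)).real
      {V : Matrix.specialUnitaryGroup (Fin 2) ℂ | ‖(V : Matrix (Fin 2) (Fin 2) ℂ) - 1‖ ≤ δ} / δ ^ (2 ^ 2 - 1)) (𝓝[>] 0) (𝓝 C₀)) :
    C₀ = 1 / (3 * Real.sqrt 2 * Real.pi) := by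
  rw [show (2 : ℕ) ^ 2 - 1 = 3 by norm_num] at h
  exact tendsto_nhds_unique h tendsto_haar_sball_div_cube_SU2

end SU2

end Summit.QuantumFields.BalabanUV.T4Continuum.Spine.NE7c.LiveFactorWindowTightSUN

end
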